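import Summits.QuantumFields.YangMills.Theorems.BalabanUVNodesN06Row17LocalCentreCoerciveReduction
import Summits.QuantumFields.YangMills.Theorems.BalabanUVNodesN06Row17LocalCentreLettersOfRealLetters
import Literature.MathematicalPhysics.QuantumFieldTheory.Balaban1983to89.B9Eq211PoincareAtLettersY
import Literature.MathematicalPhysics.QuantumFieldTheory.Balaban1983to89.B9LocalAxialDecompositionY
import Literature.MathematicalPhysics.QuantumFieldTheory.Balaban1983to89.B9LocalLemma24AtLettersY
import Literature.MathematicalPhysics.QuantumFieldTheory.Balaban1983to89.B9LocalCubeGeometryOneLevelY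
import Literature.MathematicalPhysics.QuantumFieldTheory.Balaban1983to89.B9DeltaAOneCoerciveOneLevelY

/-!
# BalabanUVNodes ∕ N06 ([B9], `Dag.B9_main`) — ROW 17's LOCAL CENTRE NUMBER `m_□` FROM ONE REAL LETTER: the `hco` binder of the local road
# (`…LocalClauseOnReg335OfL5Letters.posDefTr_padDeltaALocY_of_L5_of_regYP335`) at `U = 1` with an EXPLICIT `m_□`, GIVEN ONLY the LOCAL LEMMA-2.4 LETTER on the
# real gauged class `𝒯ᵣ(D)` at def-Y's box kernels — the (2.11) letter (`B9Eq211PoincareAtLettersY`), the supported axial decomposition (`B9LocalAxialDecompositionY`),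
# the entrywise assembly and the reduction (this seat's g24 files) composed (ROAD «C» W0 half (b): everything but Lemma 2.4 discharged)

Track A of `YM-PLAN.md` (cell `pub-ymgap`, HUMAN RULING D-0062), node **N06** = [Balaban1985BackgroundPropagators] Thms 3.1–3.15; seat `pub-ymgap-dag-n06-j`
(bundle F5, rows 15–17), g24.  A HELPER (count-neutral, `--supports` only).

THE PRINT.  [B9] p. 416: *«In [4] we have proved that the operator G_□(1) is positive»*; [4] = [Balaban1984PropagatorsII] p. 226 («bounded from below by a positive
constant»), Lemma 2.4 (2.128) p. 245: *«L^{d−2} Σ_{c∈Λ′} |(Q₁B)(c)|² + Σ_p |(∂₁B)(p)|² ≥ (1∕(12d²)) L^{−d−1} ‖B‖²»* for `B` in the gauge (2.121), p. 239: *«otherwise the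
operator G_□ is simply equal to the operator G_j on the torus»*.

WHAT.  ★★★ `coer_trIP_padDeltaALocY_one_of_lemma24_letter`: for a cube site set `D` that is a union of blocks of the member's partition, 0∕1 cuts `χP`, `χ` with `χ`
issuing from `D`, and a constant `κ > 0` such that the REAL LOCAL LEMMA-2.4 LETTER holds —
  (Rᴸ²⁴) every real bond field `v` whose staircase sums from the block corners vanish on every block inside `D` and which vanishes on every bond with both end
  points outside `D` satisfies `κ·Σ_b v(b)² ≤ Σ_p ((curlK·v)(p))² + Σ_ι w(ι)·((qK·v)(ι))²` —
then **`min 1 γ · ⟨Ψ,Ψ⟩₁ ≤ ⟨Ψ, padDeltaALocY i parSymY parBY D (cutMulY χP) (cutMulY χ) 1 Ψ⟩₁` for EVERY `Ψ`**, `γ = (2∕κ + (4∕π)(1 + 4(d+1)c_f²∕κ))⁻¹`,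
`π = 8c_f²∕L^{2k}` — the `hco` binder with `m := min 1 γ`.  ★★★ `coer_trIP_padDeltaALocY_one_of_cube_geometry`: (Rᴸ²⁴) supplied by `B9LocalLemma24AtLettersY.
local_lemma24_real` (dag-n10-c's C4 ∕ pv09's Lemma 2.4 localised) — **the `hco` binder at `U = 1` with an EXPLICIT `m_□ = min 1 γ(κ_j, π)` FROM THE CUBE's GEOMETRY ALONE**:
`D` a union of member blocks (`hD`) and of level-`j` torus blocks (`hDj`) which are member `Λ_j`-sites (`hDLam`), every level-`j` bond one of whose end blocks meets `D`
a member index bond (`hNbr`, «non-deeper neighbours»), weights `≥ w₀ > 0` on the level-`j` index bonds, `χ` issuing from `D` — the one-level-cube scope of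
dag-n10-c's census v22.1 §1 as a formal hypothesis list (the interface cubes are ROAD «C» station C6).  ★★★ `coer_trIP_padDeltaALocY_one_cubeDomY_of_oneLevel`:
AT W-a's `D := cubeDomY x c` (the road of record's cube site set) for a ONE-LEVEL enlarged cube (`hone`) with non-deeper neighbours (`hNbr`) and `0 < b₀`: the
three set-theoretic cube hypotheses discharged by `B9LocalCubeGeometryOneLevelY`, the weight floor `w₀ := b₀·c_f²` by `B9DeltaAOneCoerciveOneLevelY.w_lower_of_globalBand`
— **the `hco` binder of `posDefTr_padDeltaALocY_of_L5_of_regYP335` at `U = 1` with an explicit `m_□(d, L, j, c_f, b₀, k)`**; `lamBond_of_lev_le` and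
★★★ `coer_trIP_padDeltaALocY_one_cubeDomY_of_oneLevel_of_lev` read the neighbour hypothesis in p21's LEVEL language: «every fine site of a level-`j` block joined
by a level-`j` bond to a block meeting `□̃(c)` has level `≤ j`» (no deeper neighbour); ★★★ `coer_trIP_padDeltaALocY_one_cubeDomY_of_lev_eq_top`: for
TOP-TORUS members (`lev ≡ k`) the bound holds for EVERY cube with NO geometric hypothesis.
HONEST FRAMING.  Composition of this seat's g24 files over dag-n10-c's C1–C4 and def-Y's FILE 40; the cube geometry DISPLAYED; nothing of [B9]'s or [4]'s estimates
asserted beyond the landed kernel theorems; COUNT-NEUTRAL; N06 ∕ N10 NOT discharged; nothing continuum ∕ OS ∕ mass gap ∕ Clay.  0 `def`, 0 `sorry`.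
-/

noncomputable section

namespace Summit.QuantumFields.YangMills.BalabanUVNodes.N06Row17LocalCentreOfLemma24

open Literature.MathematicalPhysics.QuantumFieldTheory.Balaban1983to89
open Literature.MathematicalPhysics.QuantumFieldTheory.Balaban1983to89.Node00
open Literature.MathematicalPhysics.QuantumFieldTheory.Balaban1983to89.Node00.OpsYDeltaALocal (padDeltaALocY)
open Literature.MathematicalPhysics.QuantumFieldTheory.Balaban1983to89.B9Thm311ReadingCoords (trIP)
open Literature.MathematicalPhysics.QuantumFieldTheory.Balaban1983to89.B9Thm37CubeCoverCommutators (cutMulY)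
open Literature.MathematicalPhysics.QuantumFieldTheory.Balaban1983to89.B6KLevelCensusIndexV1 (KIdx)
open Literature.MathematicalPhysics.QuantumFieldTheory.Balaban1983to89.B6GlobalChartV1 (PV domT toBox iterBlockOf_mem_domT_iff)
open Literature.MathematicalPhysics.QuantumFieldTheory.Balaban1983to89.B6ScalarChartV1 (exists_iterBlockOf_eq)
open Literature.MathematicalPhysics.QuantumFieldTheory.Balaban1983to89.B6SectALemma24OneLevelV1 (cornerV1)
open Literature.MathematicalPhysics.QuantumFieldTheory.Balaban1983to89.B5Eq118OneStroke (iterBlock iterBlockOf iterBlockOf_succ)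
open Literature.MathematicalPhysics.QuantumFieldTheory.Balaban1983to89.LatticeFieldCalculus (stairSum)
open Literature.MathematicalPhysics.QuantumFieldTheory.Balaban1983to89.B9Eq211PoincareAtLettersY (sum_sq_le_sum_sq_gradK_of_qpK poincare211_const_pos)
open Literature.MathematicalPhysics.QuantumFieldTheory.Balaban1983to89.B9LocalAxialDecompositionY (exists_supported_axial_decomposition)
open Literature.MathematicalPhysics.QuantumFieldTheory.Balaban1983to89.B9LocalLemma24AtLettersY (local_lemma24_real local_lemma24_const_pos)
open Literature.MathematicalPhysics.QuantumFieldTheory.Balaban1983to89.Node00.OpsYNablaBridge (chartY)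
open Literature.MathematicalPhysics.QuantumFieldTheory.Balaban1983to89.B9LocalCubeGeometryOneLevelY (cubeDomY_dichotomy_lamSite cubeDomY_dichotomy_level
  lamSite_of_block_subset_cubeDomY)
open Literature.MathematicalPhysics.QuantumFieldTheory.Balaban1983to89.B9DeltaAOneCoerciveOneLevelY (w_lower_of_globalBand)
open Literature.MathematicalPhysics.QuantumFieldTheory.Balaban1983to89.B9WalkLettersCoordsS (cubeDomY)
open Literature.MathematicalPhysics.QuantumFieldTheory.Balaban1983to89.B6Cover236MultiLevelBlocks (cubes)
open Literature.MathematicalPhysics.QuantumFieldTheory.Balaban1983to89.B9PinMembersKLevelV1 (MemberY)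
open Summit.QuantumFields.YangMills.BalabanUVNodes.N06Row17LocalCentreCoercive (coer_trIP_padDeltaALocY_one_of_classes)
open Summit.QuantumFields.YangMills.BalabanUVNodes.N06Row17LocalCentreLetters (local_letters_of_real_letters)
open scoped Matrix
open scoped Matrix.Norms.L2Operator

variable {N : ℕ} {d ℓ : ℕ} {hd : 1 ≤ d + 1} {hL : Odd (ℓ + 1) ∧ 1 < ℓ + 1} {b₀ b₁ : ℝ} (i : KIdx d ℓ hd hL b₀ b₁)

/-- ★★★ **ROW 17's LOCAL CENTRE NUMBER FROM THE LOCAL LEMMA-2.4 LETTER ALONE.**  `D` a union of blocks of the member's partition, `χP`, `χ` 0∕1 cuts, `χ` issuing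
from `D`, `κ > 0` with the real local Lemma-2.4 letter (Rᴸ²⁴) on the gauged class `𝒯ᵣ(D)` ⟹ **`min 1 γ · ⟨Ψ,Ψ⟩₁ ≤ ⟨Ψ, padDeltaALocY … (cutMulY χ) 1 Ψ⟩₁` for every
`Ψ`**, `γ = (2∕κ + (4∕π)(1 + 4(d+1)c_f²∕κ))⁻¹`, `π = 8c_f²∕(ℓ+1)^{2k}` — the supported axial decomposition (`exists_supported_axial_decomposition`), (2.11) on
`N(Q′(1))` (`sum_sq_le_sum_sq_gradK_of_qpK`), the entrywise assembly (`local_letters_of_real_letters`) and the reduction (`coer_trIP_padDeltaALocY_one_of_classes`).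
[cite: Balaban1985BackgroundPropagators, Thm 3.11 proof p.416, Cor. 3.6 p.408, pp.408–409 (G_□); Balaban1984PropagatorsII, p.226, (2.19) p.226, (2.11) p.225, (2.7) p.224, Lemma 2.4 (2.128) p.245, (2.121) p.244] -/
theorem coer_trIP_padDeltaALocY_one_of_lemma24_letter (D : Finset (SiteY i))
    (hD : ∀ (j : ℕ) (y : Site (PV d ℓ i.m i.K hd hL) j), (domT i.hN i.D i.hk).LamSite j y →
      (∀ x ∈ iterBlock j y, chartY i x ∈ D) ∨ (∀ x ∈ iterBlock j y, chartY i x ∉ D))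
    {χP : BlkY i → ℝ} (hχP : ∀ y, χP y = 0 ∨ χP y = 1) {χ : FBondY i → ℝ} (hχ : ∀ b, χ b = 0 ∨ χ b = 1)
    (hχD : ∀ b, χ b ≠ 0 → chartY i b.src ∈ D) {κ : ℝ} (hκ : 0 < κ)
    (hL24r : ∀ v : FBondY i → ℝ,
      (∀ (j : ℕ) (y : Site (PV d ℓ i.m i.K hd hL) j), (domT i.hN i.D i.hk).LamSite j y → (∀ x ∈ iterBlock j y, chartY i x ∈ D) →
        ∀ x ∈ iterBlock j y, stairSum v (cornerV1 j y) x = 0) →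
      (∀ b : FBondY i, chartY i b.src ∉ D → chartY i b.tgt ∉ D → v b = 0) →
      κ * ∑ b, v b ^ 2 ≤ ∑ p, (curlK i *ᵥ v) p ^ 2 + ∑ ι, i.w ι * (qK i *ᵥ v) ι ^ 2)
    (Ψ : FBondY i → Matrix (Fin N) (Fin N) ℂ) :
    min 1 (2 / κ + 4 / (8 * i.cf ^ 2 / ((((ℓ + 1 : ℕ) : ℝ)) ^ i.k) ^ 2) * (1 + 4 * ((d + 1 : ℕ) : ℝ) * i.cf ^ 2 / κ))⁻¹ *
        trIP (fun _ => (1 : ℝ)) Ψ Ψ ≤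
      trIP (fun _ => (1 : ℝ)) Ψ
        (padDeltaALocY i (parSymY i) (parBY i) D (cutMulY χP) (cutMulY χ) (fun _ _ => 1 : CfgY (Matrix (Fin N) (Fin N) ℂ) i) Ψ) := by
  -- the real gauged class `𝒯ᵣ(D)`
  obtain ⟨𝒯, 𝒩, h1, h2, h3⟩ := local_letters_of_real_letters (N := N) i D χ (κ := κ)
    (π := 8 * i.cf ^ 2 / ((((ℓ + 1 : ℕ) : ℝ)) ^ i.k) ^ 2)
    {v : FBondY i → ℝ |
      (∀ (j : ℕ) (y : Site (PV d ℓ i.m i.K hd hL) j), (domT i.hN i.D i.hk).LamSite j y → (∀ x ∈ iterBlock j y, chartY i x ∈ D) →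
        ∀ x ∈ iterBlock j y, stairSum v (cornerV1 j y) x = 0) ∧
      (∀ b : FBondY i, chartY i b.src ∉ D → chartY i b.tgt ∉ D → v b = 0)}
    (fun v hv => hL24r v hv.1 hv.2) (fun g hg _ => sum_sq_le_sum_sq_gradK_of_qpK i hg)
    (fun v => by
      obtain ⟨g, hq, hsupp, hst, hoff⟩ := exists_supported_axial_decomposition i D hD hχD v
      exact ⟨g, hq, hsupp, hst, hoff⟩)
  exact coer_trIP_padDeltaALocY_one_of_classes i D hχP hχ hκ (poincare211_const_pos i) 𝒯 𝒩 h1 h2 h3 Ψ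

/-- ★★★ **ROW 17's LOCAL CENTRE NUMBER `m_□` AT `U = 1` FROM THE CUBE's GEOMETRY ALONE (one-level cubes with non-deeper neighbours).**  For a level `j ≤ m + K`,
a cube site set `D` that is a union of member blocks and of level-`j` torus blocks which are member `Λ_j`-sites, such that every level-`j` bond one of whose end
blocks meets `D` is a member index bond, weights `≥ w₀ > 0` on the level-`j` index bonds, 0∕1 cuts `χP`, `χ` with `χ` issuing from `D`:
**`min 1 γ · ⟨Ψ,Ψ⟩₁ ≤ ⟨Ψ, padDeltaALocY i parSymY parBY D (cutMulY χP) (cutMulY χ) 1 Ψ⟩₁` for EVERY `Ψ`**, `γ = (2∕κ_j + (4∕π)(1 + 4(d+1)c_f²∕κ_j))⁻¹`,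
`κ_j = (1∕(12(d+1)²))·((Lʲ)^{d+2})⁻¹·min(c_f², w₀∕(Lʲ)^{d−1})`, `π = 8c_f²∕L^{2k}` — [4]'s «G_□(1) positive» with an explicit constant, at def-Y's FILE 40 letters:
`coer_trIP_padDeltaALocY_one_of_lemma24_letter` ∘ `B9LocalLemma24AtLettersY.local_lemma24_real`.
[cite: Balaban1985BackgroundPropagators, Thm 3.11 proof p.416 («In [4] we have proved that the operator G_□(1) is positive»), Cor. 3.6 p.408, pp.408–409; Balaban1984PropagatorsII, p.226, p.239 («G_□ is simply equal to the operator G_j on the torus»), Lemma 2.4 (2.128) p.245, (2.11) p.225, (2.7) p.224] -/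
theorem coer_trIP_padDeltaALocY_one_of_cube_geometry (hd2 : 2 ≤ d + 1) {j : ℕ} (hj : j ≤ i.m + i.K) (D : Finset (SiteY i))
    (hD : ∀ (j' : ℕ) (y : Site (PV d ℓ i.m i.K hd hL) j'), (domT i.hN i.D i.hk).LamSite j' y →
      (∀ x ∈ iterBlock j' y, chartY i x ∈ D) ∨ (∀ x ∈ iterBlock j' y, chartY i x ∉ D))
    (hDj : ∀ yk : Site (PV d ℓ i.m i.K hd hL) j, (∀ x ∈ iterBlock j yk, chartY i x ∈ D) ∨ (∀ x ∈ iterBlock j yk, chartY i x ∉ D))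
    (hDLam : ∀ yk : Site (PV d ℓ i.m i.K hd hL) j, (∀ x ∈ iterBlock j yk, chartY i x ∈ D) → (domT i.hN i.D i.hk).LamSite j yk)
    (hNbr : ∀ bb : PBond (PV d ℓ i.m i.K hd hL) j, ¬ (domT i.hN i.D i.hk).LamBond j bb →
      ∀ x : Site (PV d ℓ i.m i.K hd hL) 0, (iterBlockOf j x = bb.src ∨ iterBlockOf j x = bb.tgt) → chartY i x ∉ D)
    {w₀ : ℝ} (hw₀ : 0 < w₀) (hw : ∀ ι : IBondY i, (ι.1.1 : ℕ) = j → w₀ ≤ i.w ι)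
    {χP : BlkY i → ℝ} (hχP : ∀ y, χP y = 0 ∨ χP y = 1) {χ : FBondY i → ℝ} (hχ : ∀ b, χ b = 0 ∨ χ b = 1)
    (hχD : ∀ b, χ b ≠ 0 → chartY i b.src ∈ D) (Ψ : FBondY i → Matrix (Fin N) (Fin N) ℂ) :
    min 1 (2 / (1 / (12 * (((d + 1 : ℕ) : ℝ)) ^ 2) * (((((ℓ + 1 : ℕ) : ℝ)) ^ j) ^ (d + 1 + 1))⁻¹ *
              min (i.cf ^ 2) (w₀ / ((((ℓ + 1 : ℕ) : ℝ)) ^ j) ^ (d + 1 - 2))) +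
          4 / (8 * i.cf ^ 2 / ((((ℓ + 1 : ℕ) : ℝ)) ^ i.k) ^ 2) *
            (1 + 4 * ((d + 1 : ℕ) : ℝ) * i.cf ^ 2 /
              (1 / (12 * (((d + 1 : ℕ) : ℝ)) ^ 2) * (((((ℓ + 1 : ℕ) : ℝ)) ^ j) ^ (d + 1 + 1))⁻¹ *
                min (i.cf ^ 2) (w₀ / ((((ℓ + 1 : ℕ) : ℝ)) ^ j) ^ (d + 1 - 2)))))⁻¹ *
        trIP (fun _ => (1 : ℝ)) Ψ Ψ ≤
      trIP (fun _ => (1 : ℝ)) Ψ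
        (padDeltaALocY i (parSymY i) (parBY i) D (cutMulY χP) (cutMulY χ) (fun _ _ => 1 : CfgY (Matrix (Fin N) (Fin N) ℂ) i) Ψ) :=
  coer_trIP_padDeltaALocY_one_of_lemma24_letter i D hD hχP hχ hχD (local_lemma24_const_pos i j hw₀)
    (fun v hst hoff => local_lemma24_real i hd2 hj D hDj hDLam hNbr hw₀ hw v hst hoff) Ψ

/-- ★★★ **ROW 17's LOCAL CENTRE NUMBER AT W-a's `□̃(c)`, `U = 1`, FOR A ONE-LEVEL ENLARGED CUBE WITH NON-DEEPER NEIGHBOURS.**  For a member `x`, a cover cube `c`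
whose enlarged cube `□̃(c)` meets member blocks of ONE level `j` (`hone`), such that every level-`j` bond one of whose end blocks meets `□̃(c)` is a member index bond
(`hNbr`), a positive weight band floor `0 < b₀`, and 0∕1 cuts `χP`, `χ` with `χ` issuing from `□̃(c)`:
**`min 1 γ · ⟨Ψ,Ψ⟩₁ ≤ ⟨Ψ, padDeltaALocY x.toKIdx parSymY parBY (cubeDomY x c) (cutMulY χP) (cutMulY χ) 1 Ψ⟩₁` for EVERY `Ψ`** with the explicit
`γ = γ(κ_j(c_f, b₀c_f²), π(c_f, k))` — the `hco` binder of the road of record at `U = 1`; [4]'s «G_□(1) is positive» with a constant, at def-Y's letters.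
[cite: Balaban1985BackgroundPropagators, Thm 3.11 proof p.416, Cor. 3.6 p.408, pp.408–409 (G_□, □̃); Balaban1984PropagatorsII, p.226, p.239, Lemma 2.4 (2.128) p.245, (2.11) p.225, (2.16) p.225] -/
theorem coer_trIP_padDeltaALocY_one_cubeDomY_of_oneLevel {Mstar : ℕ} (x : MemberY d ℓ hd hL b₀ b₁ Mstar) (c : ↥(cubes x.toKIdx.D.toDomains))
    (hd2 : 2 ≤ d + 1) {j : ℕ} (hj : j ≤ x.m + x.K) (hone : ∀ z ∈ cubeDomY x c, x.toKIdx.D.lev z.1 = j)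
    (hNbr : ∀ bb : PBond (PV d ℓ x.m x.K hd hL) j, ¬ (domT x.toKIdx.hN x.toKIdx.D x.toKIdx.hk).LamBond j bb →
      ∀ y : Site (PV d ℓ x.m x.K hd hL) 0, (iterBlockOf j y = bb.src ∨ iterBlockOf j y = bb.tgt) → chartY x.toKIdx y ∉ cubeDomY x c)
    (hb₀ : 0 < b₀) {χP : BlkY x.toKIdx → ℝ} (hχP : ∀ y, χP y = 0 ∨ χP y = 1) {χ : FBondY x.toKIdx → ℝ} (hχ : ∀ b, χ b = 0 ∨ χ b = 1)
    (hχD : ∀ b, χ b ≠ 0 → chartY x.toKIdx b.src ∈ cubeDomY x c) (Ψ : FBondY x.toKIdx → Matrix (Fin N) (Fin N) ℂ) :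
    min 1 (2 / (1 / (12 * (((d + 1 : ℕ) : ℝ)) ^ 2) * (((((ℓ + 1 : ℕ) : ℝ)) ^ j) ^ (d + 1 + 1))⁻¹ *
              min (x.toKIdx.cf ^ 2) (b₀ * x.toKIdx.cf ^ 2 / ((((ℓ + 1 : ℕ) : ℝ)) ^ j) ^ (d + 1 - 2))) +
          4 / (8 * x.toKIdx.cf ^ 2 / ((((ℓ + 1 : ℕ) : ℝ)) ^ x.toKIdx.k) ^ 2) *
            (1 + 4 * ((d + 1 : ℕ) : ℝ) * x.toKIdx.cf ^ 2 /
              (1 / (12 * (((d + 1 : ℕ) : ℝ)) ^ 2) * (((((ℓ + 1 : ℕ) : ℝ)) ^ j) ^ (d + 1 + 1))⁻¹ *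
                min (x.toKIdx.cf ^ 2) (b₀ * x.toKIdx.cf ^ 2 / ((((ℓ + 1 : ℕ) : ℝ)) ^ j) ^ (d + 1 - 2)))))⁻¹ *
        trIP (fun _ => (1 : ℝ)) Ψ Ψ ≤
      trIP (fun _ => (1 : ℝ)) Ψ
        (padDeltaALocY x.toKIdx (parSymY x.toKIdx) (parBY x.toKIdx) (cubeDomY x c) (cutMulY χP) (cutMulY χ)
          (fun _ _ => 1 : CfgY (Matrix (Fin N) (Fin N) ℂ) x.toKIdx) Ψ) :=
  coer_trIP_padDeltaALocY_one_of_cube_geometry x.toKIdx hd2 hj (cubeDomY x c) (cubeDomY_dichotomy_lamSite x c) (cubeDomY_dichotomy_level x c hone)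
    (lamSite_of_block_subset_cubeDomY x c hj hone) hNbr (mul_pos hb₀ (sq_pos_iff.mpr x.toKIdx.hcf))
    (fun ι _ => w_lower_of_globalBand x.toKIdx hd2 hb₀.le ι) hχP hχ hχD Ψ

/-- **«NON-DEEPER NEIGHBOURS» IN THE LEVEL LANGUAGE ⟹ the index condition**: a level-`j` bond one of whose end blocks has a fine site of level `j` and both of
whose end blocks carry levels `≤ j` is a member index bond (`Λ_j`-bond: one end in `Ω_j`, no end deep — [4] (2.3); `iterBlockOf_mem_domT_iff`).
[cite: Balaban1984PropagatorsII, (2.2)–(2.3) p.224 («Λ_j = st_j(Ω_j) ∖ st_j(Ω_{j+1})»)] -/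
theorem lamBond_of_lev_le {j : ℕ} (bb : PBond (PV d ℓ i.m i.K hd hL) j)
    (hmeet : ∃ y : Site (PV d ℓ i.m i.K hd hL) 0, (iterBlockOf j y = bb.src ∨ iterBlockOf j y = bb.tgt) ∧
      i.D.lev (toBox i.hN y : Fin (d + 1) → ℤ) = j)
    (hle : ∀ y : Site (PV d ℓ i.m i.K hd hL) 0, (iterBlockOf j y = bb.src ∨ iterBlockOf j y = bb.tgt) → i.D.lev (toBox i.hN y : Fin (d + 1) → ℤ) ≤ j) :
    (domT i.hN i.D i.hk).LamBond j bb := by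
  obtain ⟨y₀, hy₀, hlev₀⟩ := hmeet
  have hj1 : 1 ≤ j := hlev₀ ▸ i.D.one_le_lev _
  have hjk : j ≤ i.k := hlev₀ ▸ i.D.lev_le _
  have hjm : j ≤ i.m + i.K := hjk.trans i.hk
  -- no end block is deep
  have hnotDeep : ∀ z : Site (PV d ℓ i.m i.K hd hL) j, (z = bb.src ∨ z = bb.tgt) → ¬ (domT i.hN i.D i.hk).Deep j z := by
    intro z hz hdeep
    obtain ⟨y, hy⟩ := exists_iterBlockOf_eq (hd := hd) (hL := hL) hjm z
    have hyz : iterBlockOf j y = bb.src ∨ iterBlockOf j y = bb.tgt := by rcases hz with h | h <;> [left; right] <;> rw [hy, h]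
    have hley := hle y hyz
    unfold B6SectADomainsV1.Domains.Deep at hdeep
    rw [← hy, ← iterBlockOf_succ] at hdeep
    by_cases hjk1 : j + 1 ≤ i.k
    · have h := (iterBlockOf_mem_domT_iff i.hN i.D i.hk (by omega) hjk1 y).1 hdeep
      omega
    · rw [(domT i.hN i.D i.hk).Om_eq_empty (show (domT i.hN i.D i.hk).k < j + 1 from by show i.k < j + 1; omega)] at hdeep
      exact Finset.notMem_empty _ hdeep
  refine ⟨?_, hnotDeep _ (Or.inl rfl), hnotDeep _ (Or.inr rfl)⟩
  have hmem : iterBlockOf j y₀ ∈ (domT i.hN i.D i.hk).Om j := (iterBlockOf_mem_domT_iff i.hN i.D i.hk hj1 hjk y₀).2 hlev₀.ge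
  rcases hy₀ with h | h
  · exact Or.inl (h ▸ hmem)
  · exact Or.inr (h ▸ hmem)

/-- ★★★ **ROW 17's LOCAL CENTRE NUMBER AT W-a's `□̃(c)`, `U = 1` — NEIGHBOUR HYPOTHESIS IN THE LEVEL LANGUAGE.**  As `coer_trIP_padDeltaALocY_one_cubeDomY_of_oneLevel`,
with «non-deeper neighbours» read as: every fine site whose level-`j` block is an end block of a level-`j` bond meeting `□̃(c)` has level `≤ j` (`hNbrLev`).
[cite: Balaban1985BackgroundPropagators, Thm 3.11 proof p.416, pp.408–409; Balaban1984PropagatorsII, (2.3) p.224, p.239, Lemma 2.4 (2.128) p.245] -/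
theorem coer_trIP_padDeltaALocY_one_cubeDomY_of_oneLevel_of_lev {Mstar : ℕ} (x : MemberY d ℓ hd hL b₀ b₁ Mstar) (c : ↥(cubes x.toKIdx.D.toDomains))
    (hd2 : 2 ≤ d + 1) {j : ℕ} (hj : j ≤ x.m + x.K) (hone : ∀ z ∈ cubeDomY x c, x.toKIdx.D.lev z.1 = j)
    (hNbrLev : ∀ bb : PBond (PV d ℓ x.m x.K hd hL) j,
      (∃ y : Site (PV d ℓ x.m x.K hd hL) 0, (iterBlockOf j y = bb.src ∨ iterBlockOf j y = bb.tgt) ∧ chartY x.toKIdx y ∈ cubeDomY x c) →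
      ∀ y : Site (PV d ℓ x.m x.K hd hL) 0, (iterBlockOf j y = bb.src ∨ iterBlockOf j y = bb.tgt) →
        x.toKIdx.D.lev (toBox x.toKIdx.hN y : Fin (d + 1) → ℤ) ≤ j)
    (hb₀ : 0 < b₀) {χP : BlkY x.toKIdx → ℝ} (hχP : ∀ y, χP y = 0 ∨ χP y = 1) {χ : FBondY x.toKIdx → ℝ} (hχ : ∀ b, χ b = 0 ∨ χ b = 1)
    (hχD : ∀ b, χ b ≠ 0 → chartY x.toKIdx b.src ∈ cubeDomY x c) (Ψ : FBondY x.toKIdx → Matrix (Fin N) (Fin N) ℂ) :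
    min 1 (2 / (1 / (12 * (((d + 1 : ℕ) : ℝ)) ^ 2) * (((((ℓ + 1 : ℕ) : ℝ)) ^ j) ^ (d + 1 + 1))⁻¹ *
              min (x.toKIdx.cf ^ 2) (b₀ * x.toKIdx.cf ^ 2 / ((((ℓ + 1 : ℕ) : ℝ)) ^ j) ^ (d + 1 - 2))) +
          4 / (8 * x.toKIdx.cf ^ 2 / ((((ℓ + 1 : ℕ) : ℝ)) ^ x.toKIdx.k) ^ 2) *
            (1 + 4 * ((d + 1 : ℕ) : ℝ) * x.toKIdx.cf ^ 2 /
              (1 / (12 * (((d + 1 : ℕ) : ℝ)) ^ 2) * (((((ℓ + 1 : ℕ) : ℝ)) ^ j) ^ (d + 1 + 1))⁻¹ *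
                min (x.toKIdx.cf ^ 2) (b₀ * x.toKIdx.cf ^ 2 / ((((ℓ + 1 : ℕ) : ℝ)) ^ j) ^ (d + 1 - 2)))))⁻¹ *
        trIP (fun _ => (1 : ℝ)) Ψ Ψ ≤
      trIP (fun _ => (1 : ℝ)) Ψ
        (padDeltaALocY x.toKIdx (parSymY x.toKIdx) (parBY x.toKIdx) (cubeDomY x c) (cutMulY χP) (cutMulY χ)
          (fun _ _ => 1 : CfgY (Matrix (Fin N) (Fin N) ℂ) x.toKIdx) Ψ) := by
  refine coer_trIP_padDeltaALocY_one_cubeDomY_of_oneLevel x c hd2 hj hone (fun bb hbb y hy => ?_) hb₀ hχP hχ hχD Ψ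
  -- contrapositive: a bond failing the index condition has no end block meeting `□̃(c)`
  intro hyD
  refine hbb (lamBond_of_lev_le x.toKIdx bb ⟨y, hy, ?_⟩ (hNbrLev bb ⟨y, hy, hyD⟩))
  exact hone _ hyD

/-- ★★★ **TOP-TORUS MEMBERS: `hco` FOR EVERY CUBE, NO GEOMETRIC HYPOTHESIS.**  For a member whose torus family has constant level (`lev ≡ k`, «Ω_j = T_η» — the
one-level members of `B9DeltaAOneCoerciveOneLevelY`), EVERY enlarged cube `□̃(c)` is one-level with `j = k` and has no deeper neighbour (`lev ≤ k` always), so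
**`min 1 γ · ⟨Ψ,Ψ⟩₁ ≤ ⟨Ψ, padDeltaALocY x.toKIdx parSymY parBY (cubeDomY x c) (cutMulY χP) (cutMulY χ) 1 Ψ⟩₁` for every cube `c`, all 0∕1 cuts with `χ` issuing
from `□̃(c)`, every `Ψ`** (`0 < b₀`). [cite: Balaban1985BackgroundPropagators, Thm 3.11 proof p.416, pp.408–409; Balaban1984PropagatorsII, p.224 («Ω_j = T_η»), p.239, Lemma 2.4 (2.128) p.245] -/
theorem coer_trIP_padDeltaALocY_one_cubeDomY_of_lev_eq_top {Mstar : ℕ} (x : MemberY d ℓ hd hL b₀ b₁ Mstar) (c : ↥(cubes x.toKIdx.D.toDomains))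
    (hd2 : 2 ≤ d + 1) (hlev : ∀ z : SiteY x.toKIdx, x.toKIdx.D.lev z.1 = x.toKIdx.k)
    (hb₀ : 0 < b₀) {χP : BlkY x.toKIdx → ℝ} (hχP : ∀ y, χP y = 0 ∨ χP y = 1) {χ : FBondY x.toKIdx → ℝ} (hχ : ∀ b, χ b = 0 ∨ χ b = 1)
    (hχD : ∀ b, χ b ≠ 0 → chartY x.toKIdx b.src ∈ cubeDomY x c) (Ψ : FBondY x.toKIdx → Matrix (Fin N) (Fin N) ℂ) :
    min 1 (2 / (1 / (12 * (((d + 1 : ℕ) : ℝ)) ^ 2) * (((((ℓ + 1 : ℕ) : ℝ)) ^ x.toKIdx.k) ^ (d + 1 + 1))⁻¹ *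
              min (x.toKIdx.cf ^ 2) (b₀ * x.toKIdx.cf ^ 2 / ((((ℓ + 1 : ℕ) : ℝ)) ^ x.toKIdx.k) ^ (d + 1 - 2))) +
          4 / (8 * x.toKIdx.cf ^ 2 / ((((ℓ + 1 : ℕ) : ℝ)) ^ x.toKIdx.k) ^ 2) *
            (1 + 4 * ((d + 1 : ℕ) : ℝ) * x.toKIdx.cf ^ 2 /
              (1 / (12 * (((d + 1 : ℕ) : ℝ)) ^ 2) * (((((ℓ + 1 : ℕ) : ℝ)) ^ x.toKIdx.k) ^ (d + 1 + 1))⁻¹ *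
                min (x.toKIdx.cf ^ 2) (b₀ * x.toKIdx.cf ^ 2 / ((((ℓ + 1 : ℕ) : ℝ)) ^ x.toKIdx.k) ^ (d + 1 - 2)))))⁻¹ *
        trIP (fun _ => (1 : ℝ)) Ψ Ψ ≤
      trIP (fun _ => (1 : ℝ)) Ψ
        (padDeltaALocY x.toKIdx (parSymY x.toKIdx) (parBY x.toKIdx) (cubeDomY x c) (cutMulY χP) (cutMulY χ)
          (fun _ _ => 1 : CfgY (Matrix (Fin N) (Fin N) ℂ) x.toKIdx) Ψ) :=
  coer_trIP_padDeltaALocY_one_cubeDomY_of_oneLevel_of_lev x c hd2 x.toKIdx.hk (fun z _ => hlev z)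
    (fun _ _ y _ => (hlev (toBox x.toKIdx.hN y)).le) hb₀ hχP hχ hχD Ψ

end Summit.QuantumFields.YangMills.BalabanUVNodes.N06Row17LocalCentreOfLemma24

end
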